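import Literature.AlgebraicGeometry.AbelianSchemes.SerreTensorPoints
import Literature.AlgebraicGeometry.AbelianSchemes.SerreTensorModuleMap
import Literature.Algebra.Module.IdempotentPresentation
import HarnessLib

/-!
# Naturality of `(A ⊗_𝒪 𝔞)(T) ≅ A(T) ⊗_𝒪 𝔞`: in `T`, in equivariant `g : A → A′`, and in `𝒪`-linear `φ : 𝔞 → 𝔞′`

Topic `AlgebraicGeometry/AbelianSchemes`, namespace `Literature.AlgebraicGeometry.AbelianSchemes.AbelianSchemeOver` (constructions with
bodies + proved theorems; no named fact, no `sorry`, no `instance`, no notation; any base `S`).  Cell `hodgecm-mathlib`, F0/P6 «MOD», P6a organ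
(g2) FILE 12 (FILE 10 `SerreTensorPoints`, FILE 7 ★ `SerreTensorModuleMap`, FILE 3 ★ `SerreTensorFunctoriality`, FILE 9 ★
`Algebra/Module/IdempotentPresentation`); `--supports stmt-HodgeConjecture-24832`, count-neutral.  HC_CM is proved only modulo the 2 remaining
named inputs (hLiu418, h413) until rung 0 closes; this file discharges none of them.

## Mathematics

The identification `Ψ : (A ⊗_𝒪 𝔞)(T) ≅ A(T) ⊗_𝒪 𝔞` of FILE 10 (`𝔞 = E·𝒪ⁿ`) is compatible with the three functorialities of Serre's
construction: (1) base change of the test object `t : T′ → T` (both sides precompose with `t`); (2) an `𝒪`-equivariant homomorphism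
`g : A → A′` — the points map of `g ⊗ 𝔞` (FILE 3 `serreMap`) is `g(T) ⊗ id_𝔞`; (3) an `𝒪`-linear map `φ : 𝔞 → 𝔞′` of presented modules —
the points map of `A ⊗ φ` (FILE 7 `serrePresentationHom` of the matrix `P(φ)` of FILE 9) is `id_{A(T)} ⊗ φ`.  Together: Serre's tensor
construction represents the functor `T ↦ A(T) ⊗_𝒪 𝔞`, naturally in `A` and `𝔞` (B. Conrad, *Gross–Zagier revisited* §7, Thm. 7.2:
`M ⊗_𝒪 A` represents `T ↦ M ⊗_𝒪 A(T)` for finite projective `M`).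

## Contents

* §1 `Pts.map g hga : act.Pts T →ₗ[O] act'.Pts T` (`hom_map`), `serrePtsEquiv_comap_coe` (naturality in `T`);
* §2 **`serrePtsTensorEquiv_serreMap`**: `Ψ′ ((g ⊗ 𝔞)(T) x) = (g(T) ⊗ id) (Ψ x)`;
* §3 `matrixCompRect_smul_pt` (the coordinate computation `P·(f_k • y)_k = ((P f)_j • y)_j`),
  **`serrePtsTensorEquiv_serrePresentationHom`**: `Ψ′ ((A ⊗ φ)(T) x) = (id ⊗ φ) (Ψ x)` for `P = presMatrix E E' φ`.

## References
* [Conrad2004GrossZagier] B. Conrad, *Gross–Zagier revisited*, MSRI Publ. 49 (2004), §7 (Thm. 7.2).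
* [Kottwitz1992] §5 (p. 390).
-/

noncomputable section

universe u

open CategoryTheory CategoryTheory.Limits AlgebraicGeometry MonoidalCategory CartesianMonoidalCategory
open scoped MonObj TensorProduct

namespace Literature.AlgebraicGeometry.AbelianSchemes

namespace AbelianSchemeOver

open RingAction Literature.Algebra.Module.IdempotentMatrix

variable {S : Scheme.{u}} {A A' : AbelianSchemeOver S} {O : Type*} [CommRing O] (act : A.RingAction O) (act' : A'.RingAction O)
  [IsCommMonObj A.X] [IsCommMonObj A'.X]

/-! ## §1 Points maps of equivariant homomorphisms; naturality in `T` -/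

section Map

variable (T : Over S) (g : A.X ⟶ A'.X) [IsMonHom g] (hga : ∀ a, act.i a ≫ g = g ≫ act'.i a)

/-- The `𝒪`-linear points map `A(T) → A′(T)`, `x ↦ x ≫ g`, of an equivariant homomorphism `g`. [cite: Conrad2004GrossZagier, §7] -/
def RingAction.Pts.map : act.Pts T →ₗ[O] act'.Pts T where
  toFun x := Pts.mk act' T (Pts.hom act T x ≫ g)
  map_add' x y := by
    apply Pts.hom_injective act' T
    change (Pts.hom act T x * Pts.hom act T y) ≫ g = (Pts.hom act T x ≫ g) * (Pts.hom act T y ≫ g)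
    rw [MonObj.mul_comp]
  map_smul' a x := by
    apply Pts.hom_injective act' T
    change (Pts.hom act T x ≫ act.i a) ≫ g = (Pts.hom act T x ≫ g) ≫ act'.i a
    rw [Category.assoc, hga, Category.assoc]

/-- `hom (map g x) = hom x ≫ g`. [cite: Conrad2004GrossZagier, §7] -/
theorem RingAction.Pts.hom_map (x : act.Pts T) : Pts.hom act' T (Pts.map act act' T g hga x) = Pts.hom act T x ≫ g := rfl

end Map

section Naturality

variable {n : ℕ} (E : Matrix (Fin n) (Fin n) O) (hE : E * E = E) (T : Over S) [IsCommMonObj (serreTensor act E hE).X]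

/-- Naturality of `serrePtsEquiv` in `T`: `Ψ (t ≫ x)_k = t ≫ Ψ(x)_k`. [cite: Conrad2004GrossZagier, §7] -/
theorem serrePtsEquiv_comap_coe {T' : Over S} (t : T' ⟶ T) (x : (serreAction act E hE).Pts T) (k : Fin n) :
    (serrePtsEquiv act E hE T' (Pts.comap (serreAction act E hE) t x) : Fin n → act.Pts T') k =
      Pts.comap act t ((serrePtsEquiv act E hE T x : Fin n → act.Pts T) k) := by
  apply Pts.hom_injective act T'
  rw [hom_serrePtsEquiv_coe, Pts.hom_comap, Pts.hom_comap, hom_serrePtsEquiv_coe, Category.assoc]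

/-- The coordinates of `Ψ⁻¹ (y ⊗ f)` as morphisms: `hom (Ψ⁻¹(y ⊗ f))_k-th coordinate `= hom y ≫ ι(f_k)`. [cite: Conrad2004GrossZagier, §7] -/
theorem hom_coord_symm_tmul (y : act.Pts T) (f : LinearMap.range (Matrix.toLin' E)) (k : Fin n) :
    (Pts.hom _ T ((serrePtsTensorEquiv act E hE T).symm (y ⊗ₜ f)) ≫ serreι act E hE) ≫ A.powProj n k =
      Pts.hom act T y ≫ act.i ((f : Fin n → O) k) := by
  rw [← hom_serrePtsFun_coe]
  change Pts.hom act T ((serrePtsEquiv act E hE T ((serrePtsTensorEquiv act E hE T).symm (y ⊗ₜ f)) : Fin n → act.Pts T) k) = _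
  rw [serrePtsTensorEquiv_symm_tmul_coe, Pts.hom_smul]

end Naturality

/-! ## §2 Compatibility with `g ⊗ 𝔞` -/

section SerreMap

variable {n : ℕ} (E : Matrix (Fin n) (Fin n) O) (hE : E * E = E) (T : Over S) (g : A.X ⟶ A'.X) [IsMonHom g]
  (hga : ∀ a, act.i a ≫ g = g ≫ act'.i a) [IsCommMonObj (serreTensor act E hE).X] [IsCommMonObj (serreTensor act' E hE).X]

/-- **Points of `g ⊗ 𝔞` are `g(T) ⊗ id_𝔞`**: `Ψ′ (x ≫ (g ⊗ 𝔞)) = (Pts.map g ⊗ id) (Ψ x)`. [cite: Conrad2004GrossZagier, §7] -/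
theorem serrePtsTensorEquiv_serreMap (x : (serreAction act E hE).Pts T) :
    haveI := isMonHom_serreMap act act' E hE g
    serrePtsTensorEquiv act' E hE T
        (Pts.map (serreAction act E hE) (serreAction act' E hE) T (serreMap act act' E hE g) (serreAction_comp_serreMap act act' E hE g hga) x) =
      LinearMap.rTensor (LinearMap.range (Matrix.toLin' E)) (Pts.map act act' T g hga) (serrePtsTensorEquiv act E hE T x) := by
  haveI := isMonHom_serreMap act act' E hE g
  -- reduce to pure tensors `x = Ψ⁻¹ (y ⊗ f)`
  obtain ⟨z, rfl⟩ := (serrePtsTensorEquiv act E hE T).symm.surjective x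
  rw [LinearEquiv.apply_symm_apply]
  induction z using TensorProduct.induction_on with
  | zero => simp only [map_zero]
  | add z₁ z₂ h₁ h₂ => simp only [map_add, h₁, h₂]
  | tmul y f =>
    rw [LinearMap.rTensor_tmul, ← LinearEquiv.eq_symm_apply]
    -- compare coordinates in `Fix_E(A′(T)ⁿ)`
    apply (serrePtsEquiv act' E hE T).injective
    apply Subtype.ext
    funext k
    apply Pts.hom_injective act' T
    rw [hom_serrePtsEquiv_coe, hom_serrePtsEquiv_coe, ← Category.assoc, ← Category.assoc, Pts.hom_map, hom_coord_symm_tmul,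
      Pts.hom_map, Category.assoc (Pts.hom act T y) g, ← hga, ← Category.assoc, ← hom_coord_symm_tmul act E hE T y f k]
    exact serreHomEquiv_comp_serreMap act act' E hE g hga _ k

end SerreMap

/-! ## §3 Compatibility with `A ⊗ φ` -/

section ModuleMap

variable {m n : ℕ} (E : Matrix (Fin n) (Fin n) O) (hE : E * E = E) (E' : Matrix (Fin m) (Fin m) O) (hE' : E' * E' = E') (T : Over S)
  [IsCommMonObj (serreTensor act E hE).X] [IsCommMonObj (serreTensor act E' hE').X]

/-- The coordinate computation: `P · (y ≫ ι(f_k))_k = (y ≫ ι((P f)_j))_j`. [cite: Kottwitz1992, §5 (p. 390)] -/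
theorem matrixCompRect_comp_i (P : Matrix (Fin m) (Fin n) O) (y : T ⟶ A.X) (f : Fin n → O) (j : Fin m) :
    matrixCompRect act P (fun k => y ≫ act.i (f k)) j = y ≫ act.i (Matrix.mulVec P f j) := by
  unfold matrixCompRect
  simp only [← act.comp_i_mul, Matrix.mulVec, dotProduct, i_finset_sum, comp_finset_prod]

/-- **Points of `A ⊗ φ` are `id_{A(T)} ⊗ φ`**: for `φ : 𝔞 → 𝔞′` with matrix `P = presMatrix E E' φ` (★ FILE 9),
`Ψ′ (x ≫ (A ⊗ P)) = (id ⊗ φ) (Ψ x)`. [cite: Conrad2004GrossZagier, §7] -/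
theorem serrePtsTensorEquiv_serrePresentationHom
    (φ : LinearMap.range (Matrix.toLin' E) →ₗ[O] LinearMap.range (Matrix.toLin' E')) (x : (serreAction act E hE).Pts T) :
    haveI := isMonHom_serrePresentationHom act E hE E' hE' (presMatrix E E' φ)
    serrePtsTensorEquiv act E' hE' T
        (Pts.map (serreAction act E hE) (serreAction act E' hE') T (serrePresentationHom act E hE E' hE' (presMatrix E E' φ))
          (serreAction_comp_serrePresentationHom_of act E hE E' hE' (presMatrix E E' φ) (presMatrix_intertwines φ hE hE')) x) =
      LinearMap.lTensor (act.Pts T) φ (serrePtsTensorEquiv act E hE T x) := by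
  haveI := isMonHom_serrePresentationHom act E hE E' hE' (presMatrix E E' φ)
  obtain ⟨z, rfl⟩ := (serrePtsTensorEquiv act E hE T).symm.surjective x
  rw [LinearEquiv.apply_symm_apply]
  induction z using TensorProduct.induction_on with
  | zero => simp only [map_zero]
  | add z₁ z₂ h₁ h₂ => simp only [map_add, h₁, h₂]
  | tmul y f =>
    rw [LinearMap.lTensor_tmul, ← LinearEquiv.eq_symm_apply]
    apply (serrePtsEquiv act E' hE' T).injective
    apply Subtype.ext
    funext j
    apply Pts.hom_injective act T
    rw [hom_serrePtsEquiv_coe, hom_serrePtsEquiv_coe, ← Category.assoc, ← Category.assoc, Pts.hom_map, hom_coord_symm_tmul]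
    have h := congrFun (serreHomEquiv_serrePresentationHom act E hE E' hE' (presMatrix E E' φ) (presMatrix_intertwines φ hE hE')
      (Pts.hom _ T ((serrePtsTensorEquiv act E hE T).symm (y ⊗ₜ f)))) j
    rw [serreHomEquiv_apply_coe] at h
    have hc : (serreHomEquiv act E hE T (Pts.hom _ T ((serrePtsTensorEquiv act E hE T).symm (y ⊗ₜ f))) : Fin n → (T ⟶ A.X)) =
        fun k => Pts.hom act T y ≫ act.i ((f : Fin n → O) k) := by
      funext k
      rw [serreHomEquiv_apply_coe, hom_coord_symm_tmul]
    rw [h, hc, matrixCompRect_comp_i, ← Matrix.toLin'_apply, toLin'_presMatrix_subtype E' φ hE f]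

end ModuleMap

end AbelianSchemeOver

end Literature.AlgebraicGeometry.AbelianSchemes

end
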